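import Mathlib
import HarnessLib
import Literature.Analysis.FluidPDE.GKPRigidityBackwardUniqueness
import Literature.Analysis.FluidPDE.CurlFreeLiouville
import Literature.Analysis.FluidPDE.TypeIAncientMildClassical
import Summits.NavierStokesRegularity.NavierStokesRegularity.Theorems.SqueezeCycleExtremalElementExistsRegularity

/-!
# Backward Liouville for Type-I ancient mild fields with an irrotational slice — crux
# stmt-NavierStokesRegularity-11739 (`IsobarTomography.TubeAlternative`), line
# `analytic-propagation-local-patch`, helper towards stub `stub_twoSidedVorticityRate`

Helper file (theorems only) for the lower half of the two-sided Type-I vorticity law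
(`IsobarTomographyTubeAlternativeStubTwoSidedVorticityRate.lean`). Main result
(`slice_eq_zero_of_curl_slice_eq_zero`): a Type-I ancient mild field `W` of the Oseen gauge
(`IsTypeIAncientMild C W`: jointly smooth on `t < 0`, divergence free, KNSS-mild between all pairs
of negative times, `‖W‖ ≤ C/√(−t)`) with an irrotational slice `W(s₀)`, `s₀ < 0`, has `W(s₀) ≡ 0`.

## Proof

* `galilean_boost` — Galilean invariance of classical solutions on an open time interval:
  `V(t, x) = W(t + c, x + t v) − v`, `Q(t, x) = q(t + c, x + t v)` is again classical (chain rules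
  for the joint derivative, translation invariance of `Δ`, `∇`, `div`).
* `curl_eq_zero_of_curl_slice_eq_zero` — irrotationality propagates backwards: the slice `W(s₀)`
  is divergence free, curl free and bounded, hence a constant `b`
  (`eq_of_curl_eq_zero_of_isDivFree_of_bounded`); `W` is classical on the window `(t − 2, 0)`
  (`IsTypeIAncientMild.exists_isClassicalNSSolutionOn_Ioo`), so the boost by `b` is classical on
  `(0, s₀ − t + 1)`, VANISHES identically at the top time and has bounded spatial derivatives of
  orders `≤ 3` (KNSS 2009, Prop. 4.1 in the class-uniform form `exists_norm_iteratedFDeriv_le_of_typeI`);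
  Escauriaza–Seregin–Šverák's backward uniqueness for the vorticity, in the tree's far-field form
  for classical solutions (`IsClassicalNSSolutionOn.curl_eq_zero_of_farField_of_tendsto`, `R = 0`),
  makes the boost, hence `W(t)`, irrotational.
* `slice_eq_zero_of_curl_slice_eq_zero` — all earlier slices are then constants, so the shifted
  field `t ↦ W(t + s₀)` is a slice-constant element of the class and vanishes
  (`IsTypeIAncientMild.eq_zero_of_slice_const`: the gauge fixes the constant in time and the Type-I
  decay kills it); continuity in time gives the slice `s₀`.

## References

* L. Escauriaza, G. Seregin, V. Šverák, Russ. Math. Surveys 58:2 (2003) 211–250, §3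
  (3.31)–(3.32), Thm. 5.1.
* G. Koch, N. Nadirashvili, G. Seregin, V. Šverák, Acta Math. 203 (2009) = arXiv:0709.3599, §1
  p. 3, Prop. 4.1, Remark 6.1.
-/

set_option linter.dupNamespace false

noncomputable section

namespace Summit.NavierStokesRegularity.NavierStokesRegularity.Theorems.TubeAlternative.AnalyticPropagation

open Set Filter Topology Function MeasureTheory Metric
open scoped RealInnerProductSpace NNReal ENNReal
open Literature.Analysis Literature.Analysis.FluidPDE
open Summit.NavierStokesRegularity.NavierStokesRegularity.Theorems

/-! ### Translation calculus and the Galilean boost of a classical solution -/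

section Galilean

open InnerProductSpace
open scoped Laplacian

variable {F : Type*} [NormedAddCommGroup F] [NormedSpace ℝ F]

/-- `Δ (f(· + a))(x) = (Δ f)(x + a)` (the Laplacian commutes with translations). [folklore] -/
theorem laplacian_comp_add_right (f : (EuclideanSpace ℝ (Fin 3)) → F) (a x : (EuclideanSpace ℝ (Fin 3))) :
    (Δ fun y => f (y + a)) x = (Δ f) (x + a) := by
  simp only [InnerProductSpace.laplacian_eq_iteratedFDeriv_stdOrthonormalBasis,
    iteratedFDeriv_comp_add_right]

/-- `∇(q(· + a))(x) = (∇q)(x + a)` (the gradient commutes with translations). [folklore] -/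
theorem gradient_comp_add_right (q : (EuclideanSpace ℝ (Fin 3)) → ℝ) (a x : (EuclideanSpace ℝ (Fin 3))) :
    gradient (fun y => q (y + a)) x = gradient q (x + a) := by
  simp only [gradient, fderiv_comp_add_right]

/-- `div (f(· + a) − v)(x) = (div f)(x + a)` (divergence of a translate minus a constant). [folklore] -/
theorem divergence_comp_add_right_sub_const (f : (EuclideanSpace ℝ (Fin 3)) → (EuclideanSpace ℝ (Fin 3))) (a v x : (EuclideanSpace ℝ (Fin 3))) :
    VectorCalculus.divergence (fun y => f (y + a) - v) x = VectorCalculus.divergence f (x + a) := by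
  simp only [VectorCalculus.divergence, fderiv_sub_const, fderiv_comp_add_right]

/-- **Galilean boost of a classical solution on an open time interval.** If `(W, q)` is a
classical solution of the unforced Navier–Stokes system on `(a, a')`, then for every `c : ℝ` and
constant velocity `v`, the boosted, time-shifted pair
`V(t, x) = W(t + c, x + t v) − v`, `Q(t, x) = q(t + c, x + t v)` is a classical solution on
`(a − c, a' − c)` (Galilean invariance; e.g. Koch–Nadirashvili–Seregin–Šverák 2009, §1: the
symmetries of the problem). [cite: KochNadirashviliSereginSverak2009, §1 p. 3 (arXiv:0709.3599)] -/
theorem galilean_boost {a a' ν : ℝ} {W : ℝ → (EuclideanSpace ℝ (Fin 3)) → (EuclideanSpace ℝ (Fin 3))} {q : ℝ → (EuclideanSpace ℝ (Fin 3)) → ℝ}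
    (h : IsClassicalNSSolutionOn (Ioo a a') ν 0 W q) (c : ℝ) (v : (EuclideanSpace ℝ (Fin 3))) :
    IsClassicalNSSolutionOn (Ioo (a - c) (a' - c)) ν 0 (fun t x => W (t + c) (x + t • v) - v)
      (fun t x => q (t + c) (x + t • v)) := by
  -- the affine change of variables `Φ(t, x) = (t + c, x + t v)`
  set Φ : ℝ × (EuclideanSpace ℝ (Fin 3)) → ℝ × (EuclideanSpace ℝ (Fin 3)) := fun z => (z.1 + c, z.2 + z.1 • v) with hΦ
  have hΦs : ContDiff ℝ (⊤ : ℕ∞) Φ :=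
    (contDiff_fst.add contDiff_const).prodMk (contDiff_snd.add (contDiff_fst.smul contDiff_const))
  have hmaps : MapsTo Φ (Ioo (a - c) (a' - c) ×ˢ univ) (Ioo a a' ×ˢ univ) := by
    rintro ⟨t, x⟩ ⟨ht, -⟩
    exact ⟨⟨by simp only [hΦ]; linarith [ht.1], by simp only [hΦ]; linarith [ht.2]⟩, mem_univ _⟩
  have hmem : ∀ {t : ℝ}, t ∈ Ioo (a - c) (a' - c) → t + c ∈ Ioo a a' := fun ht =>
    ⟨by linarith [ht.1], by linarith [ht.2]⟩
  have hW := h.smooth_velocity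
  have hq := h.smooth_pressure
  refine ⟨?_, ?_, ?_, ?_⟩
  · -- joint smoothness of the velocity
    have e : (uncurry fun t x => W (t + c) (x + t • v) - v) = fun z => uncurry W (Φ z) - v := rfl
    show ContDiffOn ℝ _ (uncurry fun t x => W (t + c) (x + t • v) - v) _
    rw [e]
    exact (hW.comp hΦs.contDiffOn hmaps).sub contDiffOn_const
  · -- joint smoothness of the pressure
    have e : (uncurry fun t x => q (t + c) (x + t • v)) = fun z => uncurry q (Φ z) := rfl
    show ContDiffOn ℝ _ (uncurry fun t x => q (t + c) (x + t • v)) _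
    rw [e]
    exact hq.comp hΦs.contDiffOn hmaps
  · -- the momentum equation
    intro t ht x
    have hτ : t + c ∈ Ioo a a' := hmem ht
    set τ : ℝ := t + c with hτdef
    set y : (EuclideanSpace ℝ (Fin 3)) := x + t • v with hy
    have hmom := h.momentum τ hτ y
    -- derivatives of `W` at `(τ, y)`
    have hWd : DifferentiableAt ℝ (uncurry W) (τ, y) :=
      (hW.contDiffAt isOpen_Ioo hτ y).differentiableAt (by simp)
    set D : ℝ × (EuclideanSpace ℝ (Fin 3)) →L[ℝ] (EuclideanSpace ℝ (Fin 3)) := fderiv ℝ (uncurry W) (τ, y) with hD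
    have hWτ2 : ContDiff ℝ 2 (W τ) := (h.contDiff_velocity hτ).of_le (by norm_cast)
    have hWdiff : Differentiable ℝ (W τ) := hWτ2.differentiable (by norm_num)
    -- (T) the time derivative of the boosted field
    have hline : HasDerivAt (fun s : ℝ => ((s + c, x + s • v) : ℝ × (EuclideanSpace ℝ (Fin 3)))) ((1 : ℝ), v) t := by
      have h1 : HasDerivAt (fun s : ℝ => s + c) 1 t := (hasDerivAt_id t).add_const c
      have h2 : HasDerivAt (fun s : ℝ => x + s • v) v t := by
        simpa using ((hasDerivAt_id t).smul_const v).const_add x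
      exact h1.prodMk h2
    have hcomp : HasDerivAt (fun s : ℝ => W (s + c) (x + s • v)) (D ((1 : ℝ), v)) t := by
      have := hWd.hasFDerivAt.comp_hasDerivAt t hline
      exact this
    have hsplit : D ((1 : ℝ), v) = timeDerivWithin (Ioo a a') W τ y + fderiv ℝ (W τ) y v := by
      have e1 : ((1 : ℝ), v) = ((1 : ℝ), (0 : (EuclideanSpace ℝ (Fin 3)))) + ((0 : ℝ), v) := by simp
      rw [e1, map_add, timeDerivWithin_eq_deriv isOpen_Ioo hτ, hW.deriv_timeLine isOpen_Ioo hτ y,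
        hW.fderiv_slice_apply_of_isOpen isOpen_Ioo hτ y v]
    have hT : timeDerivWithin (Ioo (a - c) (a' - c)) (fun t x => W (t + c) (x + t • v) - v) t x =
        timeDerivWithin (Ioo a a') W τ y + fderiv ℝ (W τ) y v := by
      rw [timeDerivWithin_eq_deriv isOpen_Ioo ht, ← hsplit]
      show deriv (fun s => W (s + c) (x + s • v) - v) t = D (1, v)
      rw [deriv_sub_const, hcomp.deriv]
    -- (C) the convective term
    have hfd : fderiv ℝ (fun z => W (t + c) (z + t • v) - v) x = fderiv ℝ (W τ) y := by
      rw [fderiv_sub_const, fderiv_comp_add_right]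
    have hC : convect (fun z => W (t + c) (z + t • v) - v) (fun z => W (t + c) (z + t • v) - v) x =
        convect (W τ) (W τ) y - fderiv ℝ (W τ) y v := by
      rw [convect_apply, convect_apply, hfd, map_sub]
    -- (L) the Laplacian
    have hL : (Δ fun z => W (t + c) (z + t • v) - v) x = (Δ (W τ)) y := by
      have h1 : ContDiffAt ℝ 2 (fun z : (EuclideanSpace ℝ (Fin 3)) => W (t + c) (z + t • v)) x :=
        (hWτ2.comp (contDiff_id.add contDiff_const)).contDiffAt
      have h2 : ContDiffAt ℝ 2 (fun _ : (EuclideanSpace ℝ (Fin 3)) => v) x := contDiffAt_const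
      rw [show (fun z => W (t + c) (z + t • v) - v) = (fun z => W (t + c) (z + t • v)) - fun _ => v
        from rfl, h1.laplacian_sub h2, laplacian_const, Pi.zero_apply, sub_zero,
        laplacian_comp_add_right]
    -- (P) the pressure gradient
    have hP : gradient (fun z => q (t + c) (z + t • v)) x = gradient (q τ) y :=
      gradient_comp_add_right (q τ) (t • v) x
    -- assemble
    show timeDerivWithin (Ioo (a - c) (a' - c)) (fun t x => W (t + c) (x + t • v) - v) t x +
        convect (fun z => W (t + c) (z + t • v) - v) (fun z => W (t + c) (z + t • v) - v) x =
      ν • (Δ fun z => W (t + c) (z + t • v) - v) x - gradient (fun z => q (t + c) (z + t • v)) x +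
        (0 : ℝ → (EuclideanSpace ℝ (Fin 3)) → (EuclideanSpace ℝ (Fin 3))) t x
    rw [hT, hC, hL, hP]
    have hmom' : timeDerivWithin (Ioo a a') W τ y + convect (W τ) (W τ) y =
        ν • (Δ (W τ)) y - gradient (q τ) y := by simpa using hmom
    simp only [Pi.zero_apply, add_zero]
    rw [← hmom']
    abel
  · -- incompressibility
    intro t ht x
    show VectorCalculus.divergence (fun z => W (t + c) (z + t • v) - v) x = 0
    rw [divergence_comp_add_right_sub_const]
    exact h.divFree (t + c) (hmem ht) _

end Galilean


/-! ### Backward uniqueness: an irrotational slice of a Type-I ancient mild field vanishes -/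

section BackwardLiouville

/-- **Irrotationality propagates backwards** (Escauriaza–Seregin–Šverák backward uniqueness for
the vorticity, through the tree's `IsClassicalNSSolutionOn.curl_eq_zero_of_farField_of_tendsto`).
Let `W` be a Type-I ancient mild field (`IsTypeIAncientMild C W`) whose slice at some `s₀ < 0` is
irrotational. Then every earlier slice is irrotational. Proof: the slice `W(s₀)` is `C²`,
divergence free, curl free and bounded, hence a constant `b` (`eq_of_curl_eq_zero_of_isDivFree_of_bounded`);
`W` is classical on the window `(t − 2, 0)` (`IsTypeIAncientMild.exists_isClassicalNSSolutionOn_Ioo`),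
so the Galilean boost `V(t', x) = W(t' + t − 1, x + t' b) − b` is classical on `(0, s₀ − t + 1)`,
has all spatial derivatives of orders `≤ 3` bounded there (KNSS's class-uniform bounds
`exists_norm_iteratedFDeriv_le_of_typeI`) and VANISHES identically at the top time `s₀ − t + 1`;
the far-field backward-uniqueness theorem (with `R = 0`) makes `V`, hence `W`, irrotational at
the intermediate time `t' = 1`, i.e. at `t`. [cite: EscauriazaSereginSverak2003, §3 (3.31)–(3.32) and Thm. 5.1] -/
theorem curl_eq_zero_of_curl_slice_eq_zero {C : ℝ} {W : ℝ → (EuclideanSpace ℝ (Fin 3)) → (EuclideanSpace ℝ (Fin 3))} (hW : IsTypeIAncientMild C W)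
    {s₀ : ℝ} (hs₀ : s₀ < 0) (hcurl : ∀ x, curl (W s₀) x = 0) {t : ℝ} (ht : t < s₀) :
    ∀ x, curl (W t) x = 0 := by
  have hC : 0 ≤ C := hW.nonneg
  -- ## Step 1: the slice `W s₀` is a constant `b`
  have hb : ∀ x, W s₀ x = W s₀ 0 := fun x =>
    eq_of_curl_eq_zero_of_isDivFree_of_bounded ((hW.contDiff_slice hs₀).of_le (by norm_cast))
      hcurl (hW.isDivFree hs₀) (fun x => hW.norm_le hs₀ x) x 0
  set b : (EuclideanSpace ℝ (Fin 3)) := W s₀ 0 with hbdef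
  -- ## Step 2: a classical window and its Galilean boost
  obtain ⟨q, hq⟩ := hW.exists_isClassicalNSSolutionOn_Ioo (t₀ := t - 2) (by linarith)
  set c : ℝ := t - 1 with hcdef
  set V : ℝ → (EuclideanSpace ℝ (Fin 3)) → (EuclideanSpace ℝ (Fin 3)) := fun t' x => W (t' + c) (x + t' • b) - b with hVdef
  set Q : ℝ → (EuclideanSpace ℝ (Fin 3)) → ℝ := fun t' x => q (t' + c) (x + t' • b) with hQdef
  have hV : IsClassicalNSSolutionOn (Ioo (t - 2 - c) (0 - c)) 1 0 V Q := galilean_boost hq c b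
  set L : ℝ := s₀ - t + 1 with hLdef
  have hL1 : 1 < L := by rw [hLdef]; linarith
  have hLc : L + c = s₀ := by rw [hLdef, hcdef]; ring
  have hV' : IsClassicalNSSolutionOn (Ioo 0 L) 1 0 V Q :=
    hV.mono (Ioo_subset_Ioo (by rw [hcdef]; linarith) (by rw [hLdef, hcdef]; linarith))
      isOpen_Ioo.uniqueDiffOn
  -- ## Step 3: bounds for the spatial derivatives of orders `≤ 3`
  have hWc := hW.continuousOn_uncurry
  have hWdiv : ∀ τ < 0, IsWeaklyDivFree (W τ) := fun τ hτ => hW.isWeaklyDivFree hτ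
  have hWmild : ∀ s s' : ℝ, s < s' → s' < 0 → ∀ x,
      W s' x = UnboundedOperators.heatExtension (W s) (s' - s) x - oseenDuhamel 1 s W W s' x :=
    fun s s' hss' hs' x => hW.mild_eq_heatExtension hss' hs' x
  have hWI := hW.hasTypeITimeDecay
  have hab : t - 2 < s₀ / 2 := by linarith
  have hb2 : s₀ / 2 < 0 := by linarith
  obtain ⟨K₁, hK₁⟩ := exists_norm_iteratedFDeriv_le_of_typeI C 1 hab hb2 one_pos
  obtain ⟨K₂, hK₂⟩ := exists_norm_iteratedFDeriv_le_of_typeI C 2 hab hb2 one_pos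
  obtain ⟨K₃, hK₃⟩ := exists_norm_iteratedFDeriv_le_of_typeI C 3 hab hb2 one_pos
  -- the uniform bound of the velocity on the window
  set M₀ : ℝ := C / Real.sqrt (-(s₀ / 2)) with hM₀
  have hM₀0 : 0 ≤ M₀ := by positivity
  have hWM₀ : ∀ τ : ℝ, τ < s₀ / 2 → ∀ z, ‖W τ z‖ ≤ M₀ := fun τ hτ z =>
    (hW.norm_le (hτ.trans hb2) z).trans (div_le_div_of_nonneg_left hC (Real.sqrt_pos.2 (by linarith))
      (Real.sqrt_le_sqrt (by linarith)))
  have hbM₀ : ‖b‖ ≤ M₀ := hWM₀ s₀ (by linarith) 0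
  -- window times of the boost
  have hτwin : ∀ t' : ℝ, 1 / 2 < t' → t' < L - s₀ / 2 →
      t' + c ∈ Ico (t - 2 + 1) (s₀ / 2) ∧ t' + c < s₀ / 2 := by
    intro t' h1 h2
    refine ⟨⟨by rw [hcdef]; linarith, ?_⟩, ?_⟩ <;> rw [hcdef] <;> rw [hLdef] at h2 <;> linarith
  have hVnorm : ∀ t' : ℝ, 1 / 2 < t' → t' < L - s₀ / 2 → ∀ x, ‖V t' x‖ ≤ 2 * M₀ := by
    intro t' h1 h2 x
    obtain ⟨-, hlt⟩ := hτwin t' h1 h2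
    calc ‖V t' x‖ = ‖W (t' + c) (x + t' • b) - b‖ := rfl
      _ ≤ ‖W (t' + c) (x + t' • b)‖ + ‖b‖ := norm_sub_le _ _
      _ ≤ M₀ + M₀ := add_le_add (hWM₀ _ hlt _) hbM₀
      _ = 2 * M₀ := by ring
  -- higher derivatives of the boost are translates of those of `W`
  have hVder : ∀ n : ℕ, n ≠ 0 → ∀ t' : ℝ, t' + c < 0 → ∀ x,
      iteratedFDeriv ℝ n (V t') x = iteratedFDeriv ℝ n (W (t' + c)) (x + t' • b) := by
    intro n hn t' ht' x
    have hWs : ContDiff ℝ n (W (t' + c)) := (hW.contDiff_slice ht').of_le (by exact_mod_cast le_top)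
    have h1 : ContDiffAt ℝ n (fun z : (EuclideanSpace ℝ (Fin 3)) => W (t' + c) (z + t' • b)) x :=
      (hWs.comp (contDiff_id.add contDiff_const)).contDiffAt
    have h2 : ContDiffAt ℝ n (fun _ : (EuclideanSpace ℝ (Fin 3)) => b) x := contDiffAt_const
    show iteratedFDeriv ℝ n (fun z => W (t' + c) (z + t' • b) - b) x = _
    rw [show (fun z => W (t' + c) (z + t' • b) - b) = (fun z => W (t' + c) (z + t' • b)) - fun _ => b
      from rfl, iteratedFDeriv_sub_apply h1 h2, iteratedFDeriv_const_of_ne hn, Pi.zero_apply, sub_zero,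
      iteratedFDeriv_comp_add_right]
  set K : ℝ := max (2 * M₀) (max K₁ (max K₂ K₃)) with hKdef
  have hbd : ∀ n ≤ 3, ∀ w ∈ Ioo (1 / 2 : ℝ) L ×ˢ (closedBall (0 : (EuclideanSpace ℝ (Fin 3))) 0)ᶜ,
      ‖iteratedFDeriv ℝ n (V w.1) w.2‖ ≤ K := by
    rintro n hn ⟨t', x⟩ ⟨ht', -⟩
    have ht'2 : t' < L - s₀ / 2 := by linarith [ht'.2]
    obtain ⟨hwin, hlt⟩ := hτwin t' ht'.1 ht'2
    have hneg : t' + c < 0 := hlt.trans hb2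
    interval_cases n
    · rw [norm_iteratedFDeriv_zero]
      exact (hVnorm t' ht'.1 ht'2 x).trans (le_max_left _ _)
    · rw [hVder 1 one_ne_zero t' hneg x]
      exact (hK₁ hWc hWdiv hWmild hWI _ hwin _).trans ((le_max_left _ _).trans (le_max_right _ _))
    · rw [hVder 2 two_ne_zero t' hneg x]
      exact (hK₂ hWc hWdiv hWmild hWI _ hwin _).trans
        (((le_max_left _ _).trans (le_max_right _ _)).trans (le_max_right _ _))
    · rw [hVder 3 (by norm_num) t' hneg x]
      exact (hK₃ hWc hWdiv hWmild hWI _ hwin _).trans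
        (((le_max_right _ _).trans (le_max_right _ _)).trans (le_max_right _ _))
  -- ## Step 4: the boost vanishes at the top time, in particular weakly
  have hVL : ∀ x, V L x = 0 := fun x => by
    show W (L + c) (x + L • b) - b = 0
    rw [hLc, hb (x + L • b), sub_self]
  have hVsm := hV.smooth_velocity
  have hIo : IsOpen (Ioo (t - 2 - c) (0 - c)) := isOpen_Ioo
  have hLI : L ∈ Ioo (t - 2 - c) (0 - c) := ⟨by rw [hcdef, hLdef]; linarith, by rw [hcdef, hLdef]; linarith⟩
  have hfinal : ∀ φ : (EuclideanSpace ℝ (Fin 3)) → (EuclideanSpace ℝ (Fin 3)), FunctionSpaces.IsTestFunctionOn (⊤ : TopologicalSpace.Opens (EuclideanSpace ℝ (Fin 3))) φ →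
      Tendsto (fun t' => ∫ x, ⟪V t' x, φ x⟫) (𝓝[<] L) (𝓝 0) := by
    intro φ hφ
    have hφc : Continuous φ := hφ.contDiff.continuous
    -- the neighbourhood of `L` on which the bounds hold
    have hnhds : Ioo (1 / 2 : ℝ) (L - s₀ / 2) ∈ 𝓝 L := isOpen_Ioo.mem_nhds ⟨by linarith, by linarith⟩
    have hsub : Ioo (1 / 2 : ℝ) (L - s₀ / 2) ⊆ Ioo (t - 2 - c) (0 - c) := fun t' ht' =>
      ⟨by rw [hcdef]; linarith [ht'.1], by rw [hcdef]; rw [hLdef] at ht'; linarith [ht'.2]⟩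
    have hcontAt : ContinuousAt (fun t' => ∫ x, ⟪V t' x, φ x⟫) L := by
      refine continuousAt_of_dominated (bound := fun x => 2 * M₀ * ‖φ x‖) ?_ ?_ ?_ ?_
      · filter_upwards [hnhds] with t' ht'
        exact ((hV.contDiff_velocity (hsub ht')).continuous.inner hφc).aestronglyMeasurable
      · filter_upwards [hnhds] with t' ht'
        refine Eventually.of_forall fun x => ?_
        calc ‖⟪V t' x, φ x⟫‖ ≤ ‖V t' x‖ * ‖φ x‖ := norm_inner_le_norm _ _
          _ ≤ 2 * M₀ * ‖φ x‖ := mul_le_mul_of_nonneg_right (hVnorm t' ht'.1 ht'.2 x) (norm_nonneg _)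
      · exact ((continuous_const.mul hφc.norm).integrable_of_hasCompactSupport
          (hφ.hasCompactSupport.norm.mul_left))
      · refine Eventually.of_forall fun x => ?_
        have h1 : ContinuousAt (uncurry V) (L, x) :=
          hVsm.continuousOn.continuousAt ((hIo.prod isOpen_univ).mem_nhds ⟨hLI, mem_univ _⟩)
        have h2 : ContinuousAt (fun t' : ℝ => ((t', x) : ℝ × (EuclideanSpace ℝ (Fin 3)))) L :=
          (continuous_id.prodMk continuous_const).continuousAt
        exact (h1.comp_of_eq h2 rfl).inner continuousAt_const
    have hval : ∫ x, ⟪V L x, φ x⟫ = 0 := by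
      simp [hVL]
    have := hcontAt.tendsto
    rw [hval] at this
    exact this.mono_left nhdsWithin_le_nhds
  -- ## Step 5: backward uniqueness in the far field `{‖x‖ > 0}` ⊇ everything but the origin
  have hzero := hV'.curl_eq_zero_of_farField_of_tendsto one_pos (T₄ := 1 / 2) (by norm_num)
    (by linarith) le_rfl hbd hfinal
  -- ## Step 6: read off at `t' = 1`, i.e. at the time `t` of `W`
  intro x
  have h1 := hzero 1 ⟨by norm_num, hL1⟩ (x - b)
  have e : curl (V 1) (x - b) = curl (W t) x := by
    show curl (fun z => W (1 + c) (z + (1 : ℝ) • b) - b) (x - b) = curl (W t) x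
    rw [curl_eq_curlCLM, curl_eq_curlCLM, fderiv_sub_const, fderiv_comp_add_right, one_smul,
      sub_add_cancel, show (1 : ℝ) + c = t by rw [hcdef]; ring]
  rwa [e] at h1

/-- **An irrotational slice of a Type-I ancient mild field vanishes.** If `IsTypeIAncientMild C W`
and `curl W(s₀, ·) ≡ 0` for some `s₀ < 0`, then `W(s₀, ·) ≡ 0`: all earlier slices are
irrotational (`curl_eq_zero_of_curl_slice_eq_zero`), hence spatially constant (div–curl Liouville
for bounded fields), so the time-shifted field `t ↦ W(t + s₀)` is a slice-constant element of the
class and vanishes (`IsTypeIAncientMild.eq_zero_of_slice_const`: the Oseen gauge fixes the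
constant in time and the Type-I decay `C/√(−t) → 0`, `t → −∞`, kills it); continuity in time
gives the slice `s₀` itself. [cite: KochNadirashviliSereginSverak2009, §1 p. 3 and Remark 6.1 (arXiv:0709.3599)] -/
theorem slice_eq_zero_of_curl_slice_eq_zero {C : ℝ} {W : ℝ → (EuclideanSpace ℝ (Fin 3)) → (EuclideanSpace ℝ (Fin 3))} (hW : IsTypeIAncientMild C W)
    {s₀ : ℝ} (hs₀ : s₀ < 0) (hcurl : ∀ x, curl (W s₀) x = 0) : ∀ x, W s₀ x = 0 := by
  -- all earlier slices are irrotational, hence constant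
  have hconst : ∀ τ < s₀, ∀ x, W τ x = W τ 0 := fun τ hτ x =>
    eq_of_curl_eq_zero_of_isDivFree_of_bounded ((hW.contDiff_slice (hτ.trans hs₀)).of_le (by norm_cast))
      (curl_eq_zero_of_curl_slice_eq_zero hW hs₀ hcurl hτ) (hW.isDivFree (hτ.trans hs₀))
      (fun x => hW.norm_le (hτ.trans hs₀) x) x 0
  -- the shifted field `t ↦ W (t + s₀)` is slice-constant, hence zero
  have hsh : IsTypeIAncientMild C (fun τ => W (τ - -s₀)) := hW.comp_sub_right (by linarith)
  have hzero : ∀ τ < 0, ∀ x, W (τ - -s₀) x = 0 := fun τ hτ x =>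
    hsh.eq_zero_of_slice_const (b := fun τ => W (τ - -s₀) 0)
      (fun τ' hτ' y => hconst _ (by linarith) y) hτ x
  -- continuity at `s₀`
  intro x
  have hcont : ContinuousAt (fun τ => W τ x) s₀ := by
    have h1 : ContinuousAt (uncurry W) (s₀, x) :=
      hW.continuousOn_uncurry.continuousAt ((isOpen_Iio.prod isOpen_univ).mem_nhds ⟨hs₀, mem_univ _⟩)
    have h2 : ContinuousAt (fun τ : ℝ => ((τ, x) : ℝ × (EuclideanSpace ℝ (Fin 3)))) s₀ :=
      (continuous_id.prodMk continuous_const).continuousAt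
    exact h1.comp_of_eq h2 rfl
  have hlim : Tendsto (fun τ => W τ x) (𝓝[<] s₀) (𝓝 (W s₀ x)) :=
    hcont.tendsto.mono_left nhdsWithin_le_nhds
  have hlim0 : Tendsto (fun τ => W τ x) (𝓝[<] s₀) (𝓝 0) := by
    refine tendsto_const_nhds.congr' ?_
    filter_upwards [self_mem_nhdsWithin] with τ hτ
    have h := hzero (τ - s₀) (sub_neg.2 hτ) x
    rw [show τ - s₀ - -s₀ = τ by ring] at h
    exact h.symm
  exact tendsto_nhds_unique hlim hlim0


/-- **Registered sub-goal `stub_irrotationalSliceVanishes`** (helper of `stub_twoSidedVorticityRate`,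
line `analytic-propagation-local-patch` of crux `IsobarTomography.TubeAlternative`): a Type-I
ancient mild field of the Oseen gauge with an irrotational slice vanishes on that slice — the
explicit-binder form of `slice_eq_zero_of_curl_slice_eq_zero`. -/
theorem stub_irrotationalSliceVanishes :
    ∀ (C : ℝ) (W : ℝ → EuclideanSpace ℝ (Fin 3) → EuclideanSpace ℝ (Fin 3)),
    Literature.Analysis.FluidPDE.IsTypeIAncientMild C W → ∀ (s₀ : ℝ), s₀ < 0 →
    (∀ x : EuclideanSpace ℝ (Fin 3), Literature.Analysis.FluidPDE.curl (W s₀) x = 0) →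
    ∀ x : EuclideanSpace ℝ (Fin 3), W s₀ x = 0 :=
  fun _ _ hW _ hs₀ hcurl => slice_eq_zero_of_curl_slice_eq_zero hW hs₀ hcurl

end BackwardLiouville

end Summit.NavierStokesRegularity.NavierStokesRegularity.Theorems.TubeAlternative.AnalyticPropagation

end
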